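import Summits.KontsevichZagierPeriods.KontsevichZagierPeriods.Theses.GaussManinCertificates

/-!
# `StokesFormKernelOfPieces` — the glue of the BC2-redirect split of `StokesFormKernel`
(route GaussManinCertificates; items stmt-KontsevichZagierPeriods-19580/19581/19582; parent stmt-3011)

Crux-strategist `cstrat-stmt-KontsevichZagierPeriods-3011-r1`, 2026-08-17.

`StokesFormKernel ⇐ CyclicLifting ∧ VanishingFibres`: every formal combination with value `0` lies in
`KZ.relations ⊔ ⟨fibres at real-algebraic parameters of identically vanishing forms of monodromy-cyclic families⟩`
(`CyclicLifting`, the arithmetic half), and such fibres are relations (`VanishingFibres`, the geometric half =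
`MonodromicSector` with empty exceptional set); hence the kernel of `eval` lies in `KZ.relations`, a fortiori in
`KZ.relations ⊔ ⟨Stokes instances⟩`. The seam is `sup_le` + `AddSubgroup.closure_le` (trivial seam, flagged).

Also recorded: `VanishingFibres → MonodromicSector` (take `E = ∅`) and the informational converses from the
kernel form of Conjecture 1 (`CyclicLifting` is summit-implied by `le_sup_left`; `VanishingFibres` by
`value_toIntegralRep`). [Kontsevich–Zagier 2001, §1.2] [Huber–Müller-Stach 2017, §13.1]
-/

namespace Summit.KontsevichZagierPeriods.GaussManinCertificates

open Summit.KontsevichZagierPeriods.KontsevichZagierPeriods.Theses.GaussManinCertificates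

/-- **Glue of the split** (item stmt-KontsevichZagierPeriods-19582, by name):
`CyclicLifting → VanishingFibres → StokesFormKernel`. [cite: KontsevichZagier2001, §1.2] -/
theorem stokesFormKernelOfPieces_proof : StokesFormKernelOfPieces := by
  intro h₁ h₂ c hc
  have hle : Literature.NumberTheory.Transcendental.KZ.relations ⊔ AddSubgroup.closure
      {d : Literature.NumberTheory.Transcendental.KZ.FormalRep |
        ∃ (n : ℕ) (𝓕 : Literature.AlgebraicGeometry.Motives.MonodromyCyclicFamily n)
          (P : MvPolynomial (Fin (n + 1)) ℚ) (k : ℕ) (t₀ : ℝ) (ht₀ : t₀ ∈ 𝓕.toPeriodFamily.J)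
          (halg : IsAlgebraic ℚ t₀),
          (∀ t ∈ 𝓕.toPeriodFamily.J, 𝓕.toPeriodFamily.periodFun P k t = 0) ∧
            d = Literature.NumberTheory.Transcendental.KZ.of
              (𝓕.toPeriodFamily.toIntegralRep t₀ ht₀ halg P k)} ≤
      Literature.NumberTheory.Transcendental.KZ.relations := by
    refine sup_le le_rfl ((AddSubgroup.closure_le _).mpr ?_)
    rintro d ⟨n, 𝓕, P, k, t₀, ht₀, halg, hvan, rfl⟩
    exact h₂ n 𝓕 P k hvan t₀ ht₀ halg
  exact AddSubgroup.mem_sup_left (hle (h₁ c hc))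

/-- The split assembled: `CyclicLifting → VanishingFibres → StokesFormKernel` as an implication between the
route decls (same term). [cite: KontsevichZagier2001, §1.2] -/
theorem stokesFormKernel_of_pieces (h₁ : CyclicLifting) (h₂ : VanishingFibres) : StokesFormKernel :=
  stokesFormKernelOfPieces_proof h₁ h₂

/-- `VanishingFibres` refines the route's crux `MonodromicSector` (stmt-3109): take `E = ∅`.
[cite: KontsevichZagier2001, §1.2] -/
theorem monodromicSector_of_vanishingFibres (h : VanishingFibres) : MonodromicSector := by
  intro n 𝓕 P k hvan
  exact ⟨∅, Set.finite_empty, fun t₀ ht₀ halg _ => h n 𝓕 P k hvan t₀ ht₀ halg⟩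

/-- Informational converse: the kernel form of Conjecture 1 implies `VanishingFibres` (a CONSEQUENCE of the
summit used toward it). [cite: KontsevichZagier2001, §1.2] -/
theorem vanishingFibres_of_kernel
    (hK : Literature.NumberTheory.Transcendental.KZKernelConjecture) : VanishingFibres := by
  intro n 𝓕 P k hvan t₀ ht₀ halg
  refine hK _ ?_
  rw [Literature.NumberTheory.Transcendental.KZ.eval_of,
    Literature.AlgebraicGeometry.Motives.PeriodFamily.value_toIntegralRep]
  exact hvan t₀ ht₀

/-- Informational converse: the kernel form of Conjecture 1 implies `CyclicLifting` trivially — the piece is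
SUMMIT-IMPLIED (the declared arithmetic half). [cite: KontsevichZagier2001, §1.2] -/
theorem cyclicLifting_of_kernel
    (hK : Literature.NumberTheory.Transcendental.KZKernelConjecture) : CyclicLifting :=
  fun c hc => AddSubgroup.mem_sup_left (hK c hc)

end Summit.KontsevichZagierPeriods.GaussManinCertificates
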